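import Summits.NavierStokesRegularity.NavierStokesRegularity.Theorems.SqueezeCycleExtremalElementExistsEnergy
import Literature.Analysis.FluidPDE.TypeIAncientMild
import Literature.Analysis.FluidPDE.HyperbolicDSSOrbit
import Literature.Analysis.FluidPDE.AncientSimilarityVariables
import Literature.Analysis.FluidPDE.SereginSverak2002RadialZoomLimit
import Literature.Analysis.FluidPDE.EnstrophyGronwall
import Literature.Analysis.FluidPDE.TaoEnstrophyLocalisation
import Mathlib.MeasureTheory.Integral.IntervalIntegral.IntegrationByParts
import HarnessLib

/-!
# Crux `MustSqueeze` (stmt-NavierStokesRegularity-11610), line `outward-drift-signed-flux`: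
# the time-averaged ball gradient energy `stub_gradEnergyAverage`

H5b (bounded scaled local gradient energies
`r⁻¹ ∫_{(t₀ - r², t₀)} ∫_{B_r(x₀)} ‖∇u(t)‖²_op ≤ C` on backward parabolic cylinders `Q_r(x₀, t₀)`,
`t₀ ≤ 0`) read in backward similarity variables `U = lerayOrbit u`,
`U(σ, y) = e^{-σ/2} u(-e^{-σ}, e^{-σ/2} y)`: for `ρ ≥ 1` the ball gradient energy
`E(ρ, σ) = ∫_{B_ρ(0)} |∇U(σ)|²_F` has time averages `∫_s^{s+1} E(ρ, σ) dσ ≤ 6 C ρ`.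

Proof.  (a) Chain rule `∇U(σ, y) = e^{-σ} ∇u(t, λ y)`, `t = -e^{-σ}`, `λ = e^{-σ/2}`, and the zoom
`y ↦ λ y` give `E(ρ, σ) = λ ∫_{B_{ρλ}(0)} |∇u(t)|²_F`.  (b) For `σ ∈ [s, s + 1]` the radius
`ρλ ≤ r := ρ e^{-s/2}`, and `|·|²_F ≤ 3 ‖·‖²_op` on `ℝ³`, so
`E(ρ, σ) ≤ 3 λ H(t) = 3 e^{σ/2} H(t) e^{-σ} ≤ 3 e^{(s+1)/2} H(t(σ)) e^{-σ}` with
`H(t) := ∫_{B_r(0)} ‖∇u(t)‖²_op`, continuous on `t < 0` (joint smoothness of the class).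
(c) The substitution `t = -e^{-σ}`, `dt = e^{-σ} dσ` turns `∫_s^{s+1} H(t(σ)) e^{-σ} dσ` into
`∫_{t₁}^{t₀} H`, `t₁ = -e^{-s}`, `t₀ = -e^{-s-1}`.  (d) `(t₁, t₀) ⊆ (t₀ - r², t₀)` because `ρ ≥ 1`,
so H5b on `Q_r(0, t₀)` (top `t₀ < 0`, where `H` is continuous up to the top) gives
`∫_{t₁}^{t₀} H ≤ C r`, whence `∫_s^{s+1} E(ρ) ≤ 3 e^{(s+1)/2} C ρ e^{-s/2} = 3 √e C ρ ≤ 6 C ρ`.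
-/

noncomputable section

open MeasureTheory Set Metric Filter

namespace Summit.NavierStokesRegularity.NavierStokesRegularity.Theorems

open Literature.Analysis.FluidPDE

/-- Physical / similarity space `ℝ³`. -/
local notation "ℝ³" => EuclideanSpace ℝ (Fin 3)

/-- Homogeneity of the squared Frobenius norm: `|c A|²_F = c² |A|²_F`. [folklore] -/
theorem mustSqueeze_frobeniusNormSq_smul (c : ℝ) (A : ℝ³ →L[ℝ] ℝ³) :
    frobeniusNormSq (c • A) = c ^ 2 * frobeniusNormSq A := by
  unfold frobeniusNormSq
  rw [Finset.mul_sum]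
  refine Finset.sum_congr rfl fun i _ => ?_
  rw [_root_.smul_apply, norm_smul, mul_pow, Real.norm_eq_abs, sq_abs]

/-- **The ball gradient energy of the orbit is a rescaled physical ball gradient energy**:
`∫_{B_ρ(0)} |∇U(σ)|²_F = λ ∫_{B_{ρλ}(0)} |∇u(-e^{-σ})|²_F`, `λ = e^{-σ/2}` (chain rule
`∇U(σ, y) = e^{-σ} ∇u(t, λy)` and the zoom `y ↦ λ y` with Jacobian `λ⁻³`). [folklore] -/
theorem mustSqueeze_ballGradEnergy_eq_zoom (u : ℝ → ℝ³ → ℝ³) (σ ρ : ℝ) :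
    ∫ y in Metric.ball (0 : ℝ³) ρ, frobeniusNormSq (fderiv ℝ (lerayOrbit u σ) y) =
      Real.exp (-σ / 2) * ∫ x in Metric.ball (0 : ℝ³) (ρ * Real.exp (-σ / 2)),
        frobeniusNormSq (fderiv ℝ (u (-Real.exp (-σ))) x) := by
  have hpos : 0 < Real.exp (-σ / 2) := Real.exp_pos _
  have e : ∀ y : ℝ³, frobeniusNormSq (fderiv ℝ (lerayOrbit u σ) y) =
      Real.exp (-σ) ^ 2 * frobeniusNormSq (fderiv ℝ (u (-Real.exp (-σ)))
        ((0 : ℝ³) + Real.exp (-σ / 2) • y)) := fun y => by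
    rw [fderiv_lerayOrbit, mustSqueeze_frobeniusNormSq_smul, zero_add]
  simp_rw [e]
  rw [integral_const_mul, SereginSverak2002.setIntegral_ball_comp_zoom
    (fun x => frobeniusNormSq (fderiv ℝ (u (-Real.exp (-σ))) x)) 0 hpos ρ, ← mul_assoc]
  congr 1
  rw [← exp_neg_half_mul_self]
  field_simp

/-- The slice gradients `(t, x) ↦ ∇u(t, x)` of a field of the class are jointly continuous on the
open past `(-∞, 0) × ℝ³` (the class is jointly `C^∞` there). [folklore] -/
theorem mustSqueeze_continuousOn_uncurry_fderiv {C : ℝ} {u : ℝ → ℝ³ → ℝ³}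
    (hu : IsTypeIAncientMild C u) :
    ContinuousOn (Function.uncurry fun t x => fderiv ℝ (u t) x) (Iio 0 ×ˢ univ) := by
  have h : IsSmoothSpaceTimeOn (Iio 0) u := hu.contDiffOn
  have h' : IsSmoothSpaceTimeOn (Iio 0) (fun t x => fderiv ℝ (u t) x) :=
    h.fderiv_slice (uniqueDiffOn_Iio 0)
  exact ContDiffOn.continuousOn h'

/-- Each slice gradient `x ↦ ∇u(t, x)`, `t < 0`, of a field of the class is continuous. [folklore] -/
theorem mustSqueeze_continuous_fderiv_slice {C : ℝ} {u : ℝ → ℝ³ → ℝ³}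
    (hu : IsTypeIAncientMild C u) {t : ℝ} (ht : t < 0) :
    Continuous fun x : ℝ³ => fderiv ℝ (u t) x :=
  (mustSqueeze_continuousOn_uncurry_fderiv hu).comp_continuous
    (continuous_const.prodMk continuous_id) fun x => ⟨ht, mem_univ x⟩

/-- **Continuity in time of the physical ball gradient energy**:
`t ↦ ∫_{B_r(0)} ‖∇u(t)‖²_op` is continuous on `t < 0` (jointly continuous integrand, dominated
convergence on the bounded ball). [folklore] -/
theorem mustSqueeze_continuousOn_ballGradOpEnergy {C : ℝ} {u : ℝ → ℝ³ → ℝ³}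
    (hu : IsTypeIAncientMild C u) (r : ℝ) :
    ContinuousOn (fun t => ∫ x in Metric.ball (0 : ℝ³) r, ‖fderiv ℝ (u t) x‖ ^ 2) (Iio 0) :=
  continuousOn_setIntegral_ball_norm_sq_of_continuousOn (g := fun t x => fderiv ℝ (u t) x)
    isOpen_Iio (mustSqueeze_continuousOn_uncurry_fderiv hu) 0 r

/-- **Frobenius ball energy against operator-norm ball energy**: for `t < 0` and `a ≤ r`,
`∫_{B_a(0)} |∇u(t)|²_F ≤ 3 ∫_{B_r(0)} ‖∇u(t)‖²_op` (monotonicity in the radius of the integral of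
the nonnegative continuous density, and `|A|²_F ≤ 3‖A‖²_op` on `ℝ³`). [folklore] -/
theorem mustSqueeze_setIntegral_frobeniusNormSq_fderiv_le {C : ℝ} {u : ℝ → ℝ³ → ℝ³}
    (hu : IsTypeIAncientMild C u) {t : ℝ} (ht : t < 0) {a r : ℝ} (har : a ≤ r) :
    ∫ x in Metric.ball (0 : ℝ³) a, frobeniusNormSq (fderiv ℝ (u t) x) ≤
      3 * ∫ x in Metric.ball (0 : ℝ³) r, ‖fderiv ℝ (u t) x‖ ^ 2 := by
  have hc := mustSqueeze_continuous_fderiv_slice hu ht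
  have hcF : Continuous fun x : ℝ³ => frobeniusNormSq (fderiv ℝ (u t) x) := by
    unfold frobeniusNormSq
    exact continuous_finsetSum _ fun i _ => ((hc.clm_apply continuous_const).norm).pow 2
  have hcN : Continuous fun x : ℝ³ => 3 * ‖fderiv ℝ (u t) x‖ ^ 2 :=
    continuous_const.mul (hc.norm.pow 2)
  have hintF : IntegrableOn (fun x : ℝ³ => frobeniusNormSq (fderiv ℝ (u t) x))
      (Metric.ball (0 : ℝ³) r) :=
    (hcF.continuousOn.integrableOn_compact (isCompact_closedBall (0 : ℝ³) r)).mono_set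
      ball_subset_closedBall
  have hintN : IntegrableOn (fun x : ℝ³ => 3 * ‖fderiv ℝ (u t) x‖ ^ 2) (Metric.ball (0 : ℝ³) r) :=
    (hcN.continuousOn.integrableOn_compact (isCompact_closedBall (0 : ℝ³) r)).mono_set
      ball_subset_closedBall
  calc ∫ x in Metric.ball (0 : ℝ³) a, frobeniusNormSq (fderiv ℝ (u t) x)
      ≤ ∫ x in Metric.ball (0 : ℝ³) r, frobeniusNormSq (fderiv ℝ (u t) x) :=
        setIntegral_mono_set hintF (Eventually.of_forall fun _ => frobeniusNormSq_nonneg _)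
          (Eventually.of_forall (ball_subset_ball har))
    _ ≤ ∫ x in Metric.ball (0 : ℝ³) r, 3 * ‖fderiv ℝ (u t) x‖ ^ 2 :=
        setIntegral_mono hintF hintN fun x => frobeniusNormSq_le_three_mul _
    _ = 3 * ∫ x in Metric.ball (0 : ℝ³) r, ‖fderiv ℝ (u t) x‖ ^ 2 := integral_const_mul _ _

/-- **Pointwise-in-`σ` bound**: for `σ ∈ [s, s + 1]` and `ρ ≥ 0`,
`E(ρ, σ) ≤ 3 e^{(s+1)/2} · H(-e^{-σ}) e^{-σ}` with `H(t) = ∫_{B_r(0)} ‖∇u(t)‖²_op`,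
`r = ρ e^{-s/2}` (zoom identity, `ρ e^{-σ/2} ≤ r`, Frobenius `≤ 3·`operator², and
`e^{-σ/2} = e^{σ/2} e^{-σ} ≤ e^{(s+1)/2} e^{-σ}`). [folklore] -/
theorem mustSqueeze_ballGradEnergy_le_pointwise {C : ℝ} {u : ℝ → ℝ³ → ℝ³}
    (hu : IsTypeIAncientMild C u) {s σ ρ : ℝ} (hρ : 0 ≤ ρ) (hσ : σ ∈ Icc s (s + 1)) :
    (∫ y in Metric.ball (0 : ℝ³) ρ, frobeniusNormSq (fderiv ℝ (lerayOrbit u σ) y)) ≤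
      3 * Real.exp ((s + 1) / 2) *
        ((∫ x in Metric.ball (0 : ℝ³) (ρ * Real.exp (-s / 2)),
          ‖fderiv ℝ (u (-Real.exp (-σ))) x‖ ^ 2) * Real.exp (-σ)) := by
  have htσ : -Real.exp (-σ) < 0 := neg_lt_zero.2 (Real.exp_pos _)
  have hrad : ρ * Real.exp (-σ / 2) ≤ ρ * Real.exp (-s / 2) := by
    gcongr
    linarith [hσ.1]
  have hslice := mustSqueeze_setIntegral_frobeniusNormSq_fderiv_le hu htσ hrad
  have h0 : 0 ≤ ∫ x in Metric.ball (0 : ℝ³) (ρ * Real.exp (-s / 2)),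
      ‖fderiv ℝ (u (-Real.exp (-σ))) x‖ ^ 2 := integral_nonneg fun _ => sq_nonneg _
  have hm : 0 ≤ (∫ x in Metric.ball (0 : ℝ³) (ρ * Real.exp (-s / 2)),
      ‖fderiv ℝ (u (-Real.exp (-σ))) x‖ ^ 2) * Real.exp (-σ) := mul_nonneg h0 (Real.exp_pos _).le
  have he : Real.exp (σ / 2) ≤ Real.exp ((s + 1) / 2) := Real.exp_le_exp.2 (by linarith [hσ.2])
  have hsplit : Real.exp (-σ / 2) = Real.exp (σ / 2) * Real.exp (-σ) := by
    rw [← Real.exp_add]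
    congr 1
    ring
  rw [mustSqueeze_ballGradEnergy_eq_zoom]
  calc Real.exp (-σ / 2) * ∫ x in Metric.ball (0 : ℝ³) (ρ * Real.exp (-σ / 2)),
        frobeniusNormSq (fderiv ℝ (u (-Real.exp (-σ))) x)
      ≤ Real.exp (-σ / 2) * (3 * ∫ x in Metric.ball (0 : ℝ³) (ρ * Real.exp (-s / 2)),
          ‖fderiv ℝ (u (-Real.exp (-σ))) x‖ ^ 2) :=
        mul_le_mul_of_nonneg_left hslice (Real.exp_pos _).le
    _ = 3 * Real.exp (σ / 2) * ((∫ x in Metric.ball (0 : ℝ³) (ρ * Real.exp (-s / 2)),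
          ‖fderiv ℝ (u (-Real.exp (-σ))) x‖ ^ 2) * Real.exp (-σ)) := by
        rw [hsplit]
        ring
    _ ≤ 3 * Real.exp ((s + 1) / 2) * ((∫ x in Metric.ball (0 : ℝ³) (ρ * Real.exp (-s / 2)),
          ‖fderiv ℝ (u (-Real.exp (-σ))) x‖ ^ 2) * Real.exp (-σ)) :=
        mul_le_mul_of_nonneg_right (mul_le_mul_of_nonneg_left he (by norm_num)) hm

/-- **The substitution `t = -e^{-σ}`** (`dt = e^{-σ} dσ`, increasing):
`∫_a^b H(-e^{-σ}) e^{-σ} dσ = ∫_{-e^{-a}}^{-e^{-b}} H(t) dt` for every `H`. [folklore] -/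
theorem mustSqueeze_intervalIntegral_comp_ancientSimTime (H : ℝ → ℝ) (a b : ℝ) :
    ∫ σ in a..b, H (-Real.exp (-σ)) * Real.exp (-σ) =
      ∫ t in (-Real.exp (-a))..(-Real.exp (-b)), H t := by
  have h := intervalIntegral.integral_comp_mul_deriv_of_deriv_nonneg (a := a) (b := b)
    (f := ancientSimTime) (f' := fun σ => Real.exp (-σ)) (g := H)
    continuous_ancientSimTime.continuousOn (fun σ _ => hasDerivAt_ancientSimTime σ)
    (fun σ _ => (Real.exp_pos _).le)
  simpa only [Function.comp_apply, ancientSimTime_apply] using h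

/-- **H5b on the cylinder `Q_r(0, t₀)`, `r = ρ e^{-s/2}`, `t₀ = -e^{-s-1}`**: for `ρ ≥ 1` the
window `(t₁, t₀)`, `t₁ = -e^{-s}`, lies inside `(t₀ - r², t₀)` (`r² = ρ² e^{-s} ≥ e^{-s}`), the
energy `H(t) = ∫_{B_r(0)} ‖∇u(t)‖²_op ≥ 0` is continuous on `[t₀ - r², t₀] ⊂ (-∞, 0)`, hence
`∫_{t₁}^{t₀} H ≤ ∫_{(t₀ - r², t₀)} H ≤ r C`. [folklore] -/
theorem mustSqueeze_window_gradOpEnergy_le {C : ℝ} {u : ℝ → ℝ³ → ℝ³}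
    (hu : IsTypeIAncientMild C u)
    (h5 : ∀ (x₀ : EuclideanSpace ℝ (Fin 3)) (t₀ r : ℝ), t₀ ≤ 0 → 0 < r →
      (∀ t, t₀ - r^2 < t → t < t₀ → r⁻¹ * ∫ x in Metric.ball x₀ r, ‖u t x‖^2 ≤ C) ∧
      r⁻¹ * ∫ t in Set.Ioo (t₀ - r^2) t₀, ∫ x in Metric.ball x₀ r, ‖fderiv ℝ (u t) x‖^2 ≤ C)
    {ρ : ℝ} (hρ : 1 ≤ ρ) (s : ℝ) :
    ∫ t in (-Real.exp (-s))..(-Real.exp (-(s + 1))),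
        (∫ x in Metric.ball (0 : ℝ³) (ρ * Real.exp (-s / 2)), ‖fderiv ℝ (u t) x‖ ^ 2) ≤
      ρ * Real.exp (-s / 2) * C := by
  have hρ0 : 0 < ρ := one_pos.trans_le hρ
  have hr0 : 0 < ρ * Real.exp (-s / 2) := mul_pos hρ0 (Real.exp_pos _)
  have ht₀ : -Real.exp (-(s + 1)) < 0 := neg_lt_zero.2 (Real.exp_pos _)
  have ht₁t₀ : -Real.exp (-s) ≤ -Real.exp (-(s + 1)) :=
    neg_le_neg (Real.exp_le_exp.2 (by linarith))
  -- H5b on the cylinder `Q_r(0, t₀)`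
  have h5b := (h5 0 (-Real.exp (-(s + 1))) (ρ * Real.exp (-s / 2)) ht₀.le hr0).2
  rw [inv_mul_le_iff₀ hr0] at h5b
  -- continuity, hence integrability, of `H` on the closed window
  have hHc := mustSqueeze_continuousOn_ballGradOpEnergy hu (ρ * Real.exp (-s / 2))
  have hsub : Icc (-Real.exp (-(s + 1)) - (ρ * Real.exp (-s / 2)) ^ 2) (-Real.exp (-(s + 1))) ⊆
      Iio 0 := fun t ht => lt_of_le_of_lt ht.2 ht₀
  have hint : IntegrableOn
      (fun t => ∫ x in Metric.ball (0 : ℝ³) (ρ * Real.exp (-s / 2)), ‖fderiv ℝ (u t) x‖ ^ 2)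
      (Ioo (-Real.exp (-(s + 1)) - (ρ * Real.exp (-s / 2)) ^ 2) (-Real.exp (-(s + 1)))) :=
    ((hHc.mono hsub).integrableOn_compact isCompact_Icc).mono_set Ioo_subset_Icc_self
  -- the window `(t₁, t₀)` lies inside `(t₀ - r², t₀)`
  have hleft : -Real.exp (-(s + 1)) - (ρ * Real.exp (-s / 2)) ^ 2 ≤ -Real.exp (-s) := by
    have hsq : (ρ * Real.exp (-s / 2)) ^ 2 = ρ ^ 2 * Real.exp (-s) := by
      rw [mul_pow, sq (Real.exp _), exp_neg_half_mul_self]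
    have h1 : Real.exp (-s) ≤ ρ ^ 2 * Real.exp (-s) :=
      le_mul_of_one_le_left (Real.exp_pos _).le (one_le_pow₀ hρ)
    have h2 := Real.exp_pos (-(s + 1))
    rw [hsq]
    linarith
  rw [intervalIntegral.integral_of_le ht₁t₀, integral_Ioc_eq_integral_Ioo]
  refine le_trans (setIntegral_mono_set hint ?_ ?_) h5b
  · exact Eventually.of_forall fun t => integral_nonneg fun x => sq_nonneg _
  · exact Eventually.of_forall (Ioo_subset_Ioo_left hleft)

/-- **stub_gradEnergyAverage** — H5b read in similarity variables: for `ρ ≥ 1`,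
`∫_s^{s+1} E(ρ, σ) dσ ≤ 6Cρ` (`E(ρ,σ) = √(−t)∫_{B_{ρ√(−t)}}|∇u(t)|²_F`, `t = −e^{−σ}`, `dσ = dt/(−t)`;
Frobenius `≤ 3·`operator²; H5b on the cylinder `Q_r(0, t₁/e)`, `r = ρ√(−t₁)`, `t₁ = −e^{−s}`,
gives `≤ 3√e·Cρ`). Continuity of `E(ρ, ·)` is supplied. -/
theorem stub_gradEnergyAverage : ∀ (C : ℝ) (u : ℝ → ℝ³ → ℝ³), IsTypeIAncientMild C u →
    (∀ (x₀ : EuclideanSpace ℝ (Fin 3)) (t₀ r : ℝ), t₀ ≤ 0 → 0 < r →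
      (∀ t, t₀ - r^2 < t → t < t₀ → r⁻¹ * ∫ x in Metric.ball x₀ r, ‖u t x‖^2 ≤ C) ∧
      r⁻¹ * ∫ t in Set.Ioo (t₀ - r^2) t₀, ∫ x in Metric.ball x₀ r, ‖fderiv ℝ (u t) x‖^2 ≤ C) →
    (∀ ρ : ℝ, 0 < ρ →
      Continuous fun s => ∫ y in Metric.ball (0 : ℝ³) ρ, frobeniusNormSq (fderiv ℝ (lerayOrbit u s) y)) →
    ∀ (s ρ : ℝ), 1 ≤ ρ →
      ∫ σ in s..(s + 1), (∫ y in Metric.ball (0 : ℝ³) ρ, frobeniusNormSq (fderiv ℝ (lerayOrbit u σ) y))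
        ≤ 6 * C * ρ := by
  intro C u hu h5 hcont s ρ hρ
  have hC : 0 ≤ C := hu.nonneg
  have hρ0 : 0 < ρ := one_pos.trans_le hρ
  -- H5b on the cylinder, in the window `(t₁, t₀)`
  have hwin := mustSqueeze_window_gradOpEnergy_le hu h5 hρ s
  -- the continuous majorant `σ ↦ 3 e^{(s+1)/2} H(-e^{-σ}) e^{-σ}`
  have hHc := mustSqueeze_continuousOn_ballGradOpEnergy hu (ρ * Real.exp (-s / 2))
  have hφ : Continuous fun σ : ℝ => 3 * Real.exp ((s + 1) / 2) *
      ((∫ x in Metric.ball (0 : ℝ³) (ρ * Real.exp (-s / 2)),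
        ‖fderiv ℝ (u (-Real.exp (-σ))) x‖ ^ 2) * Real.exp (-σ)) := by
    have he : Continuous fun σ : ℝ => Real.exp (-σ) := Real.continuous_exp.comp continuous_neg
    have h1 : Continuous fun σ : ℝ => ∫ x in Metric.ball (0 : ℝ³) (ρ * Real.exp (-s / 2)),
        ‖fderiv ℝ (u (-Real.exp (-σ))) x‖ ^ 2 :=
      hHc.comp_continuous he.neg fun σ => neg_lt_zero.2 (Real.exp_pos _)
    exact continuous_const.mul (h1.mul he)
  -- the substitution `t = -e^{-σ}`
  have hsubst := mustSqueeze_intervalIntegral_comp_ancientSimTime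
    (fun t => ∫ x in Metric.ball (0 : ℝ³) (ρ * Real.exp (-s / 2)), ‖fderiv ℝ (u t) x‖ ^ 2)
    s (s + 1)
  -- `√e ≤ 2`
  have h2 : Real.exp (1 / 2) ≤ 2 := by
    have := Real.exp_bound_div_one_sub_of_interval (x := 1 / 2) (by norm_num) (by norm_num)
    norm_num at this
    exact this
  have hprod : Real.exp ((s + 1) / 2) * Real.exp (-s / 2) = Real.exp (1 / 2) := by
    rw [← Real.exp_add]
    congr 1
    ring
  calc ∫ σ in s..(s + 1), (∫ y in Metric.ball (0 : ℝ³) ρ,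
        frobeniusNormSq (fderiv ℝ (lerayOrbit u σ) y))
      ≤ ∫ σ in s..(s + 1), 3 * Real.exp ((s + 1) / 2) *
          ((∫ x in Metric.ball (0 : ℝ³) (ρ * Real.exp (-s / 2)),
            ‖fderiv ℝ (u (-Real.exp (-σ))) x‖ ^ 2) * Real.exp (-σ)) :=
        intervalIntegral.integral_mono_on (by linarith) ((hcont ρ hρ0).intervalIntegrable _ _)
          (hφ.intervalIntegrable _ _) fun σ hσ => mustSqueeze_ballGradEnergy_le_pointwise hu hρ0.le hσ
    _ = 3 * Real.exp ((s + 1) / 2) * ∫ t in (-Real.exp (-s))..(-Real.exp (-(s + 1))),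
          (∫ x in Metric.ball (0 : ℝ³) (ρ * Real.exp (-s / 2)), ‖fderiv ℝ (u t) x‖ ^ 2) := by
        rw [intervalIntegral.integral_const_mul, hsubst]
    _ ≤ 3 * Real.exp ((s + 1) / 2) * (ρ * Real.exp (-s / 2) * C) :=
        mul_le_mul_of_nonneg_left hwin (by positivity)
    _ = 3 * Real.exp (1 / 2) * C * ρ := by
        rw [← hprod]
        ring
    _ ≤ 6 * C * ρ := by
        have hCρ : 0 ≤ C * ρ := mul_nonneg hC hρ0.le
        nlinarith
end Summit.NavierStokesRegularity.NavierStokesRegularity.Theorems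

end
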